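import Literature.AlgebraicGeometry.Motives.SplitQuadricConstantFieldExtensions
import HarnessLib

/-!
# `ℙⁿ` and `X × ℙⁿ` over ALL constant field extensions `𝔽_{q^m}`:
# `Z(ℙⁿ ⊗ 𝔽_{q^m}, T) = 1/∏_{i≤n}(1 − q^{mi}T)` (simple poles), the projective bundle formula
# `Z((X × ℙⁿ) ⊗ 𝔽_{q^m}, T) = ∏_{i≤n} Z(X ⊗ 𝔽_{q^m}, q^{mi}T)`, the pole orders of `Z(X × ℙⁿ)` from those of
# `Z(X)` (products and rescalings of `HasPoleOfOrderAt`), and `φ_r(Fᵐ) = 1` on `H^{2r}(ℙⁿ)(r)` for every `m`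

Topic `Literature/AlgebraicGeometry/Motives`; THEOREMS ONLY (no definition, no instance, no named fact; D-0026).
Sequel to `Motives/ZetaFunctionOfProjectiveSpace` (`#ℙⁿ(𝔽_{q^m})`, `Z(ℙⁿ, T)·∏(1 − qⁱT) = 1`),
`Motives/ZetaFunctionOfProjectiveSpaceOverBase` (`Z(X × ℙⁿ, T) = ∏ Z(X, qⁱT)`), `Motives/ProjectiveSpaceFiniteFieldCohomology`
(`φ_r = 1` on `H^{2r}(ℙⁿ)(r)`) and g52-#7 `Motives/SplitQuadricConstantFieldExtensions` (polynomial point counts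
⟹ `H^{2r}(X)(r)_{(φ_r(Fᵐ)),1} = H^{2r}(X)(r)` for every `m`).

* §1 (E-free): **`zetaSeriesPow_projectiveSpace_mul_prod`** (`Z(ℙⁿ ⊗ 𝔽_{q^m}, T)·∏_{i≤n}(1 − (q^m)ⁱT) = 1`, `m ≥ 1`),
  **`hasPoleOfOrderAt_zetaSeriesPow_projectiveSpace`** (order EXACTLY `1` at `(q^m)^{−r}`, `r ≤ n`),
  `…_of_lt` (order `0` — no pole, no zero — at `(q^m)^{−r}`, `r > n`), and the `m = 1` forms
  `hasPoleOfOrderAt_zetaSeries_projectiveSpace{,_of_lt}`.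
* §2 (E-free): **`zetaSeriesPow_tensor_projectiveSpace`** (`Z((X × ℙⁿ) ⊗ 𝔽_{q^m}, T) = ∏_{i≤n} Z(X ⊗ 𝔽_{q^m}, (q^m)ⁱT)`,
  the projective bundle formula over `𝔽_{q^m}`), `zetaSeriesPow_projectiveSpace_tensor`,
  `zetaSeriesPow_tensor_projectiveSpace_mul_prod_rescale` (`Z_m(X)·B = 1 ⟹ Z_m(X × ℙⁿ)·∏ B((q^m)ⁱT) = 1`),
  `zetaSeriesPow_tensor_projectiveSpace_mul_coe_prod_comp` (the same with a polynomial `B`).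
* §3 (`Kahn2003.HasPoleOfOrderAt` calculus): **`HasPoleOfOrderAt.mul`** (orders add), `HasPoleOfOrderAt.one`,
  **`HasPoleOfOrderAt.prod`**, **`HasPoleOfOrderAt.rescale`** (`ord_{t₀/c} Z(cT) = ord_{t₀} Z(T)`).
* §4 (E-free): **`hasPoleOfOrderAt_zetaSeriesPow_tensor_projectiveSpace`** (`ord_{t₀} Z_m(X × ℙⁿ) =
  Σ_{i≤n} ord_{(q^m)ⁱt₀} Z_m(X)`), `hasPoleOfOrderAt_zetaSeries_tensor_projectiveSpace` (`m = 1`).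
* §5 (`E` with the trace formula, `χ(φ) = q`, RH for `ℙⁿ`): **`GaloisWeilCohomology.ρTwist_pow_projectiveSpace_two_mul_eq_one`**
  (`φ_r(Fᵐ) = 1` on `H^{2r}(ℙⁿ)(r)`, `r ≤ n`, every `m`), `ker_ρTwist_pow_sub_one_projectiveSpace_eq_top`,
  `maxGenEigenspace_ρTwist_pow_projectiveSpace_eq_top` (every `r`, `m`), `finrank_maxGenEigenspace_ρTwist_pow_projectiveSpace`
  (`= 1`, `r ≤ n`).

HC is not touched.

## References

* [Hartshorne1977] R. Hartshorne, Algebraic Geometry (1977), App. C Ex. 5.2 (the Weil conjectures for `ℙⁿ`), §1.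
* [IrelandRosen1982] K. Ireland, M. Rosen, A Classical Introduction to Modern Number Theory (1982), Ch. 11 §1.
* [Stichtenoth2009] H. Stichtenoth, Algebraic Function Fields and Codes, 2nd ed. (2009), Thm. 5.1.15 (f).
* [Kahn2020] B. Kahn, Zeta and L-Functions of Varieties and Motives (2020), Prop. 2.3 (4), (5); §6.14 Conj. 6.52.
* [Ramachandran2014] N. Ramachandran, Zeta functions, Grothendieck groups, and the Witt ring (2014), Thm. 2.1 (i),
  Rem. 2.2.
* [TateWoodsHole1965] J. Tate, Algebraic cycles and poles of zeta functions (1965), §3.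
* [Tate1994] J. Tate, Conjectures on algebraic cycles in ℓ-adic cohomology, PSPM 55.1 (1994), §1, §2 Th. 2.9.
* [Milne2012AddendumZetaValues] J. S. Milne, N. Ramachandran, addendum on zeta values (2012), §0.4 (orders of poles).
* [Gottsche1993] L. Göttsche, LNM 1572 (1993), §1.2 Remark 1.2.2.
* Tree: `Motives/ZetaFunctionOfProjectiveSpace`, `Motives/ZetaFunctionOfProjectiveSpaceOverBase`,
  `Motives/ZetaFunctionOfAffineSpace` (`countZeta_pow_mul_eq_rescale`), `Motives/ProjectiveSpaceFiniteFieldCohomology`,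
  `Motives/ClosedPointsConstantFieldExtension` (`zetaSeriesPow_eq_countZeta`), `Motives/EllipticQuadricPointCount`
  (`hasPoleOfOrderAt_of_mul_prod_pow_eq_one`, `HasPoleOfOrderAt.of_mul_coe`), `Kahn2003/RationalNumericalEquivalenceOfTate`.

## Provenance

Lane `lit-hodgefound` (summit `HodgeConjecture`, Track 2 foundations library, Layer B: motives ∕ varieties over finite
fields), seat `lit-hodgefound-p29` (literature-prover, generation 52, row g52-#8).
-/

universe u v

open Polynomial Finset CategoryTheory MonoidalCategory AlgebraicGeometry
open Literature.NumberTheory.LFunctions.Dwork (countZeta countZeta_congr countZeta_pow_mul countZeta_sum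
  countZeta_pow_mul_eq_rescale)
open Literature.AlgebraicGeometry.Kahn2003 (HasPoleOfOrderAt hasPoleOfOrderAt_of_mul_prod_pow_eq_one)

noncomputable section

/-! ### §3 The calculus of pole orders: products and rescalings -/

namespace Literature.AlgebraicGeometry.Kahn2003

open Polynomial

/-- `Z = 1` has neither pole nor zero anywhere: order `0`. [cite: Milne2012AddendumZetaValues, §0.4] -/
theorem HasPoleOfOrderAt.one (t₀ : ℚ) : HasPoleOfOrderAt 1 t₀ 0 :=
  ⟨1, 1, by rw [eval_one]; exact one_ne_zero, by rw [eval_one]; exact one_ne_zero,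
    by rw [pow_zero, mul_one, Polynomial.coe_one, mul_one]⟩

/-- **Pole orders add under products**: if `Z₁` has a pole of order exactly `ρ₁` and `Z₂` one of order exactly `ρ₂`
at `t₀` (in the sense of `HasPoleOfOrderAt`: `Zᵢ·Bᵢ·(T − t₀)^{ρᵢ} = Aᵢ`, `Aᵢ(t₀)Bᵢ(t₀) ≠ 0`), then `Z₁Z₂` has a pole of
order exactly `ρ₁ + ρ₂` there. [cite: Milne2012AddendumZetaValues, §0.4] [cite: Kahn2020, §6.14 Conj. 6.52] -/
theorem HasPoleOfOrderAt.mul {Z₁ Z₂ : PowerSeries ℚ} {t₀ : ℚ} {ρ₁ ρ₂ : ℕ} (h₁ : HasPoleOfOrderAt Z₁ t₀ ρ₁)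
    (h₂ : HasPoleOfOrderAt Z₂ t₀ ρ₂) : HasPoleOfOrderAt (Z₁ * Z₂) t₀ (ρ₁ + ρ₂) := by
  obtain ⟨A₁, B₁, hA₁, hB₁, hZ₁⟩ := h₁
  obtain ⟨A₂, B₂, hA₂, hB₂, hZ₂⟩ := h₂
  refine ⟨A₁ * A₂, B₁ * B₂, by rw [eval_mul]; exact mul_ne_zero hA₁ hA₂,
    by rw [eval_mul]; exact mul_ne_zero hB₁ hB₂, ?_⟩
  simp only [Polynomial.coe_mul, Polynomial.coe_pow] at hZ₁ hZ₂ ⊢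
  linear_combination (Z₂ * ((B₂ : PowerSeries ℚ) * ((X - C t₀ : ℚ[X]) : PowerSeries ℚ) ^ ρ₂)) * hZ₁ +
    (A₁ : PowerSeries ℚ) * hZ₂

/-- **Pole orders add under finite products.** [cite: Milne2012AddendumZetaValues, §0.4] -/
theorem HasPoleOfOrderAt.prod {ι : Type*} (s : Finset ι) {Z : ι → PowerSeries ℚ} {t₀ : ℚ} {ρ : ι → ℕ}
    (h : ∀ i ∈ s, HasPoleOfOrderAt (Z i) t₀ (ρ i)) :
    HasPoleOfOrderAt (∏ i ∈ s, Z i) t₀ (∑ i ∈ s, ρ i) := by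
  induction s using Finset.cons_induction with
  | empty => rw [Finset.prod_empty, Finset.sum_empty]; exact HasPoleOfOrderAt.one t₀
  | cons a s ha ih =>
    rw [Finset.prod_cons, Finset.sum_cons]
    exact (h a (Finset.mem_cons_self a s)).mul (ih fun i hi => h i (Finset.mem_cons_of_mem hi))

/-- `PowerSeries.rescale a` fixes constants: `(PowerSeries.rescale a) (C r) = C r` (private plumbing). [folklore] -/
private theorem rescale_C_eq' {R : Type*} [CommSemiring R] (a r : R) :
    PowerSeries.rescale a (PowerSeries.C r) = PowerSeries.C r := by
  ext i
  rw [PowerSeries.coeff_rescale, PowerSeries.coeff_C]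
  split_ifs with hi
  · rw [hi, pow_zero, one_mul]
  · rw [mul_zero]

/-- `(PowerSeries.rescale a) B = B(aT)` for a polynomial `B` viewed as a power series (private plumbing; the tree's private
`rescale_coe_polynomial` of `Motives/ZetaFunctionOfProjectiveSpaceOverBase`). [folklore] -/
private theorem rescale_coe_polynomial' {R : Type*} [CommRing R] (a : R) (B : Polynomial R) :
    PowerSeries.rescale a (B : PowerSeries R) =
      ((B.comp (Polynomial.C a * Polynomial.X) : Polynomial R) : PowerSeries R) := by
  induction B using Polynomial.induction_on' with
  | add p q hp hq => rw [Polynomial.coe_add, map_add, hp, hq, Polynomial.add_comp, Polynomial.coe_add]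
  | monomial j r =>
    rw [Polynomial.monomial_comp, ← Polynomial.C_mul_X_pow_eq_monomial, mul_pow, ← map_pow, ← mul_assoc,
      ← map_mul, Polynomial.coe_mul, Polynomial.coe_C, Polynomial.coe_pow, Polynomial.coe_X, Polynomial.coe_mul,
      Polynomial.coe_C, Polynomial.coe_pow, Polynomial.coe_X, map_mul, map_pow, rescale_C_eq', PowerSeries.rescale_X, mul_pow,
      ← map_pow, ← mul_assoc, ← map_mul]

/-- **Rescaling moves poles: `ord_{T = t₀/c} Z(cT) = ord_{T = t₀} Z(T)`** (`c ≠ 0`; `Z(cT) = PowerSeries.rescale c Z`): from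
`Z·B·(T − t₀)^ρ = A` one gets `Z(cT)·c^ρB(cT)·(T − t₀/c)^ρ = A(cT)` with `A(c·t₀/c) = A(t₀) ≠ 0`. (Kahn Prop. 2.3 (5):
`ζ(X × 𝔸¹, s) = ζ(X, s − 1)` shifts the poles by `1`.) [cite: Kahn2020, Prop. 2.3 (5)] [cite: Milne2012AddendumZetaValues, §0.4] -/
theorem HasPoleOfOrderAt.rescale {Z : PowerSeries ℚ} {t₀ : ℚ} {ρ : ℕ} (h : HasPoleOfOrderAt Z t₀ ρ) {c : ℚ}
    (hc : c ≠ 0) : HasPoleOfOrderAt (PowerSeries.rescale c Z) (t₀ / c) ρ := by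
  obtain ⟨A, B, hA, hB, hZ⟩ := h
  refine ⟨A.comp (Polynomial.C c * Polynomial.X), Polynomial.C (c ^ ρ) * B.comp (Polynomial.C c * Polynomial.X),
    ?_, ?_, ?_⟩
  · rwa [eval_comp, eval_mul, eval_C, eval_X, mul_div_cancel₀ _ hc]
  · rw [eval_mul, eval_C, eval_comp, eval_mul, eval_C, eval_X, mul_div_cancel₀ _ hc]
    exact mul_ne_zero (pow_ne_zero _ hc) hB
  · have hpoly : (Polynomial.C (c ^ ρ) * B.comp (Polynomial.C c * Polynomial.X)) *
        (Polynomial.X - Polynomial.C (t₀ / c)) ^ ρ =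
        (B * (Polynomial.X - Polynomial.C t₀) ^ ρ).comp (Polynomial.C c * Polynomial.X) := by
      rw [mul_comp, pow_comp, sub_comp, X_comp, C_comp]
      have hlin : (Polynomial.C c * Polynomial.X - Polynomial.C t₀ : ℚ[X]) =
          Polynomial.C c * (Polynomial.X - Polynomial.C (t₀ / c)) := by
        rw [mul_sub, ← Polynomial.C_mul, mul_div_cancel₀ _ hc]
      rw [hlin, mul_pow, ← Polynomial.C_pow]
      ring
    have h := congrArg (PowerSeries.rescale c) hZ
    rw [map_mul, rescale_coe_polynomial' c, rescale_coe_polynomial' c, ← hpoly] at h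
    exact h

end Literature.AlgebraicGeometry.Kahn2003

namespace Literature.AlgebraicGeometry.Motives

/-! ### §1 `Z(ℙⁿ ⊗ 𝔽_{q^m}, T)` and its simple poles -/

section EFree

variable {k : Type u} [Field k] [Finite k] (n : ℕ)

/-- **`Z(ℙⁿ ⊗ 𝔽_{q^m}, T) · ∏_{i=0}^{n} (1 − (q^m)ⁱT) = 1`** for every `m ≥ 1` (Hartshorne App. C Ex. 5.2 over the
field `𝔽_{q^m}`: `#ℙⁿ(𝔽_{q^{ms}}) = Σ_{i≤n} (q^m)^{si}`, Dwork's `countZeta`). [cite: Hartshorne1977, App. C Ex. 5.2]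
[cite: IrelandRosen1982, Ch. 11 §1] [cite: Stichtenoth2009, Theorem 5.1.15 (f)] -/
theorem zetaSeriesPow_projectiveSpace_mul_prod {m : ℕ} (hm : 0 < m) :
    zetaSeriesPow (projectiveSpace n k) m *
      ∏ i ∈ Finset.range (n + 1), ((1 - C (((Nat.card k : ℚ) ^ m) ^ i) * X : ℚ[X]) : PowerSeries ℚ) = 1 := by
  have hZ : zetaSeriesPow (projectiveSpace n k) m =
      ∏ i ∈ Finset.range (n + 1), countZeta (fun s => (((Nat.card k : ℤ) ^ m) ^ i) ^ s) := by
    rw [zetaSeriesPow_eq_countZeta, ← countZeta_sum]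
    refine countZeta_congr fun s hs => ?_
    rw [pointCount_projectiveSpace (Nat.mul_pos hm hs), Finset.sum_apply, Nat.cast_sum]
    exact Finset.sum_congr rfl fun i _ => by rw [Nat.cast_pow, ← pow_mul, ← pow_mul]; ring
  rw [hZ, ← Finset.prod_mul_distrib]
  refine Finset.prod_eq_one fun i _ => ?_
  have h := countZeta_pow_mul (((Nat.card k : ℤ) ^ m) ^ i)
  rw [Int.cast_pow, Int.cast_pow, Int.cast_natCast] at h
  exact h

/-- The same with the polynomial `∏_{i≤n}(1 − (q^m)ⁱT)^1 ∈ ℚ[T]` coerced as a whole (the shape of the tree's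
`hasPoleOfOrderAt_of_mul_prod_pow_eq_one`, base `q^m`). [cite: Hartshorne1977, App. C Ex. 5.2] -/
theorem zetaSeriesPow_projectiveSpace_mul_coe_prod_pow {m : ℕ} (hm : 0 < m) :
    zetaSeriesPow (projectiveSpace n k) m *
      ((∏ i ∈ Finset.range (n + 1), (1 - C ((((Nat.card k ^ m : ℕ) : ℚ)) ^ i) * X) ^ 1 : ℚ[X]) :
        PowerSeries ℚ) = 1 := by
  have hprod : (∏ i ∈ Finset.range (n + 1), ((1 - C (((Nat.card k : ℚ) ^ m) ^ i) * X : ℚ[X]) : PowerSeries ℚ)) =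
      ((∏ i ∈ Finset.range (n + 1), (1 - C ((((Nat.card k ^ m : ℕ) : ℚ)) ^ i) * X) ^ 1 : ℚ[X]) :
        PowerSeries ℚ) := by
    rw [← Polynomial.coeToPowerSeries.ringHom_apply, map_prod]
    refine Finset.prod_congr rfl fun i _ => ?_
    rw [Polynomial.coeToPowerSeries.ringHom_apply, pow_one, Nat.cast_pow]
  rw [← hprod]
  exact zetaSeriesPow_projectiveSpace_mul_prod n hm

/-- **The poles of `Z(ℙⁿ ⊗ 𝔽_{q^m}, T)` at `T = (q^m)^{−r}`, `r ≤ n`, are SIMPLE** for every `m ≥ 1` (one `r`-cell;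
Tate 1965 §3). [cite: TateWoodsHole1965, §3] [cite: Kahn2020, §6.14 Conj. 6.52] [cite: Hartshorne1977, App. C Ex. 5.2] -/
theorem hasPoleOfOrderAt_zetaSeriesPow_projectiveSpace {m : ℕ} (hm : 0 < m) {r : ℕ} (hr : r ≤ n) :
    HasPoleOfOrderAt (zetaSeriesPow (projectiveSpace n k) m) ((((Nat.card k : ℚ) ^ m) ^ r)⁻¹) 1 := by
  have hqm : 1 < Nat.card k ^ m := Nat.one_lt_pow hm.ne' Finite.one_lt_card
  have h := hasPoleOfOrderAt_of_mul_prod_pow_eq_one (Finset.range (n + 1)) (fun i => i) (fun _ => 1) hqm r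
    (zetaSeriesPow_projectiveSpace_mul_coe_prod_pow n hm)
  simp only [Finset.sum_const, smul_eq_mul, mul_one, Finset.filter_eq', Finset.mem_range,
    show r < n + 1 by omega, if_true, Finset.card_singleton, Nat.cast_pow] at h
  exact h

/-- **No pole and no zero of `Z(ℙⁿ ⊗ 𝔽_{q^m}, T)` at `(q^m)^{−r}` for `r > n`** (order `0`).
[cite: Hartshorne1977, App. C Ex. 5.2] [cite: TateWoodsHole1965, §3] -/
theorem hasPoleOfOrderAt_zetaSeriesPow_projectiveSpace_of_lt {m : ℕ} (hm : 0 < m) {r : ℕ} (hr : n < r) :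
    HasPoleOfOrderAt (zetaSeriesPow (projectiveSpace n k) m) ((((Nat.card k : ℚ) ^ m) ^ r)⁻¹) 0 := by
  have hqm : 1 < Nat.card k ^ m := Nat.one_lt_pow hm.ne' Finite.one_lt_card
  have h := hasPoleOfOrderAt_of_mul_prod_pow_eq_one (Finset.range (n + 1)) (fun i => i) (fun _ => 1) hqm r
    (zetaSeriesPow_projectiveSpace_mul_coe_prod_pow n hm)
  have hfilter : (Finset.range (n + 1)).filter (fun i => i = r) = ∅ :=
    Finset.filter_eq_empty_iff.mpr fun i hi h => by rw [Finset.mem_range] at hi; omega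
  rw [hfilter, Finset.sum_empty, Nat.cast_pow] at h
  exact h

/-- `m = 1`: **`Z(ℙⁿ, T)` has a SIMPLE pole at `T = q^{−r}` for every `r ≤ n`.** [cite: TateWoodsHole1965, §3]
[cite: Hartshorne1977, App. C Ex. 5.2] -/
theorem hasPoleOfOrderAt_zetaSeries_projectiveSpace {r : ℕ} (hr : r ≤ n) :
    HasPoleOfOrderAt (zetaSeries (projectiveSpace n k)) (((Nat.card k : ℚ) ^ r)⁻¹) 1 := by
  have h := hasPoleOfOrderAt_zetaSeriesPow_projectiveSpace (k := k) n one_pos hr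
  rwa [zetaSeriesPow_one, pow_one] at h

/-- `m = 1`: no pole and no zero of `Z(ℙⁿ, T)` at `q^{−r}` for `r > n`. [cite: Hartshorne1977, App. C Ex. 5.2] -/
theorem hasPoleOfOrderAt_zetaSeries_projectiveSpace_of_lt {r : ℕ} (hr : n < r) :
    HasPoleOfOrderAt (zetaSeries (projectiveSpace n k)) (((Nat.card k : ℚ) ^ r)⁻¹) 0 := by
  have h := hasPoleOfOrderAt_zetaSeriesPow_projectiveSpace_of_lt (k := k) n one_pos hr
  rwa [zetaSeriesPow_one, pow_one] at h

/-! ### §2 The projective bundle formula over `𝔽_{q^m}` -/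

variable (X : SchemeOver k)

/-- **`Z((X × ℙⁿ) ⊗ 𝔽_{q^m}, T) = ∏_{i=0}^{n} Z(X ⊗ 𝔽_{q^m}, (q^m)ⁱT)`** for every `m ≥ 1`: the projective bundle
formula for the zeta function over the constant field extension (`#(X × ℙⁿ)(𝔽_{q^{ms}}) = #X(𝔽_{q^{ms}})·Σ(q^m)^{si}`
and `Z_{(aˢN_s)}(T) = Z_N(aT)`). [cite: Kahn2020, Prop. 2.3 (4), (5)] [cite: Ramachandran2014, Thm. 2.1 (i), Rem. 2.2 (i), (iii)] -/
theorem zetaSeriesPow_tensor_projectiveSpace {m : ℕ} (hm : 0 < m) :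
    zetaSeriesPow (X ⊗ projectiveSpace n k) m =
      ∏ i ∈ Finset.range (n + 1), PowerSeries.rescale (((Nat.card k : ℚ) ^ m) ^ i) (zetaSeriesPow X m) := by
  have h : ∀ i : ℕ, PowerSeries.rescale (((Nat.card k : ℚ) ^ m) ^ i) (zetaSeriesPow X m) =
      countZeta (fun s => (((Nat.card k : ℤ) ^ m) ^ i) ^ s * (pointCount X (m * s) : ℤ)) := fun i => by
    rw [zetaSeriesPow_eq_countZeta, countZeta_pow_mul_eq_rescale, Int.cast_pow, Int.cast_pow, Int.cast_natCast]
  simp_rw [h]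
  rw [zetaSeriesPow_eq_countZeta, ← countZeta_sum]
  refine countZeta_congr fun s hs => ?_
  rw [pointCount_tensor_projectiveSpace X (Nat.mul_pos hm hs), Finset.sum_apply, Nat.cast_mul, Nat.cast_sum,
    Finset.mul_sum]
  refine Finset.sum_congr rfl fun i _ => ?_
  rw [Nat.cast_pow, ← pow_mul, ← pow_mul]
  ring

/-- `Z((ℙⁿ × X) ⊗ 𝔽_{q^m}, T) = ∏_{i=0}^{n} Z(X ⊗ 𝔽_{q^m}, (q^m)ⁱT)` (factors swapped).
[cite: Kahn2020, Prop. 2.3 (4), (5)] -/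
theorem zetaSeriesPow_projectiveSpace_tensor {m : ℕ} (hm : 0 < m) :
    zetaSeriesPow (projectiveSpace n k ⊗ X) m =
      ∏ i ∈ Finset.range (n + 1), PowerSeries.rescale (((Nat.card k : ℚ) ^ m) ^ i) (zetaSeriesPow X m) := by
  rw [← zetaSeriesPow_tensor_projectiveSpace n X hm, zetaSeriesPow_eq_countZeta, zetaSeriesPow_eq_countZeta]
  refine countZeta_congr fun s _ => ?_
  rw [pointCount_tensorObj, pointCount_tensorObj, mul_comm]

/-- **`Z_m(X)·B = 1 ⟹ Z_m(X × ℙⁿ) · ∏_{i≤n} B((q^m)ⁱT) = 1`** (`B` any power series; `Z_m = Z(− ⊗ 𝔽_{q^m}, T)`).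
[cite: Kahn2020, Prop. 2.3 (4), (5)] [cite: Ramachandran2014, Thm. 2.1 (i), Rem. 2.2 (iii)] -/
theorem zetaSeriesPow_tensor_projectiveSpace_mul_prod_rescale {m : ℕ} (hm : 0 < m) {B : PowerSeries ℚ}
    (hB : zetaSeriesPow X m * B = 1) :
    zetaSeriesPow (X ⊗ projectiveSpace n k) m *
      ∏ i ∈ Finset.range (n + 1), PowerSeries.rescale (((Nat.card k : ℚ) ^ m) ^ i) B = 1 := by
  rw [zetaSeriesPow_tensor_projectiveSpace n X hm, ← Finset.prod_mul_distrib]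
  exact Finset.prod_eq_one fun i _ => by rw [← map_mul, hB, map_one]

/-! ### §4 The pole orders of `Z(X × ℙⁿ)` from those of `Z(X)` -/

/-- **`ord_{T=t₀} Z((X × ℙⁿ) ⊗ 𝔽_{q^m}, T) = Σ_{i=0}^{n} ord_{T=(q^m)ⁱt₀} Z(X ⊗ 𝔽_{q^m}, T)`**: if `Z_m(X)` has at
`(q^m)ⁱt₀` a pole of order exactly `ρᵢ` (`ρᵢ = 0` allowed: no pole, no zero) for each `i ≤ n`, then `Z_m(X × ℙⁿ)`
has at `t₀` a pole of order exactly `Σᵢ ρᵢ` (the projective bundle formula, factor by factor). In particular with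
`t₀ = (q^m)^{−r}`: `ord_{(q^m)^{−r}} Z_m(X × ℙⁿ) = Σ_{i ≤ min(n,r)} ord_{(q^m)^{−(r−i)}} Z_m(X)` — the `r`-cycles of
`X × ℙⁿ` are the `(r−i)`-cycles of `X` times linear subspaces (Tate 1965 §3).
[cite: TateWoodsHole1965, §3] [cite: Kahn2020, Prop. 2.3 (4), (5) and §6.14 Conj. 6.52] -/
theorem hasPoleOfOrderAt_zetaSeriesPow_tensor_projectiveSpace {m : ℕ} (hm : 0 < m) {t₀ : ℚ} {ρ : ℕ → ℕ}
    (h : ∀ i ∈ Finset.range (n + 1),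
      HasPoleOfOrderAt (zetaSeriesPow X m) ((((Nat.card k : ℚ) ^ m) ^ i) * t₀) (ρ i)) :
    HasPoleOfOrderAt (zetaSeriesPow (X ⊗ projectiveSpace n k) m) t₀ (∑ i ∈ Finset.range (n + 1), ρ i) := by
  rw [zetaSeriesPow_tensor_projectiveSpace n X hm]
  refine HasPoleOfOrderAt.prod _ fun i hi => ?_
  have hc : (((Nat.card k : ℚ) ^ m) ^ i) ≠ 0 :=
    pow_ne_zero _ (pow_ne_zero _ (Nat.cast_ne_zero.mpr Nat.card_pos.ne'))
  have h' := (h i hi).rescale hc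
  rwa [mul_div_cancel_left₀ _ hc] at h'

/-- `m = 1`: **`ord_{T=t₀} Z(X × ℙⁿ, T) = Σ_{i=0}^{n} ord_{T=qⁱt₀} Z(X, T)`.** [cite: TateWoodsHole1965, §3]
[cite: Kahn2020, Prop. 2.3 (4), (5)] -/
theorem hasPoleOfOrderAt_zetaSeries_tensor_projectiveSpace {t₀ : ℚ} {ρ : ℕ → ℕ}
    (h : ∀ i ∈ Finset.range (n + 1), HasPoleOfOrderAt (zetaSeries X) (((Nat.card k : ℚ) ^ i) * t₀) (ρ i)) :
    HasPoleOfOrderAt (zetaSeries (X ⊗ projectiveSpace n k)) t₀ (∑ i ∈ Finset.range (n + 1), ρ i) := by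
  rw [← zetaSeriesPow_one]
  refine hasPoleOfOrderAt_zetaSeriesPow_tensor_projectiveSpace n X one_pos fun i hi => ?_
  rw [zetaSeriesPow_one, pow_one]
  exact h i hi

/-- Example: **`Z((ℙᵃ × ℙⁿ) ⊗ 𝔽_{q^m}, T)` has at `(q^m)^{−r}` a pole of order exactly `#{i ≤ n : i ≤ r ≤ a + i}`**
(the number of ways to write `r = i + j` with `i ≤ n`, `j ≤ a`: the `r`-cells of `ℙᵃ × ℙⁿ`).
[cite: TateWoodsHole1965, §3] [cite: Kahn2020, Prop. 2.3 (4), (5)] -/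
theorem hasPoleOfOrderAt_zetaSeriesPow_projectiveSpace_tensor_projectiveSpace (a : ℕ) {m : ℕ} (hm : 0 < m)
    (r : ℕ) :
    HasPoleOfOrderAt (zetaSeriesPow (projectiveSpace a k ⊗ projectiveSpace n k) m)
      ((((Nat.card k : ℚ) ^ m) ^ r)⁻¹)
      (∑ i ∈ Finset.range (n + 1), if i ≤ r ∧ r ≤ a + i then 1 else 0) := by
  refine hasPoleOfOrderAt_zetaSeriesPow_tensor_projectiveSpace n (projectiveSpace a k) hm fun i _ => ?_
  have hq : ((Nat.card k : ℚ) ^ m) ≠ 0 := pow_ne_zero _ (Nat.cast_ne_zero.mpr Nat.card_pos.ne')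
  by_cases hir : i ≤ r
  · -- `(q^m)ⁱ · (q^m)^{−(i+j)} = (q^m)^{−j}`
    obtain ⟨j, rfl⟩ := Nat.exists_eq_add_of_le hir
    have hpt : (((Nat.card k : ℚ) ^ m) ^ i) * ((((Nat.card k : ℚ) ^ m) ^ (i + j))⁻¹) =
        ((((Nat.card k : ℚ) ^ m) ^ j)⁻¹) := by
      rw [pow_add, mul_inv, ← mul_assoc, mul_inv_cancel₀ (pow_ne_zero _ hq), one_mul]
    rw [hpt]
    by_cases hra : i + j ≤ a + i
    · rw [if_pos ⟨hir, hra⟩]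
      exact hasPoleOfOrderAt_zetaSeriesPow_projectiveSpace a hm (by omega)
    · rw [if_neg (fun h => hra h.2)]
      exact hasPoleOfOrderAt_zetaSeriesPow_projectiveSpace_of_lt a hm (by omega)
  · -- `i > r`: the point `(q^m)^{i−r}` has absolute value `> 1`, beyond every pole `(q^m)^{−j}` of `Z_m(ℙᵃ)`
    rw [if_neg (fun h => hir h.1)]
    obtain ⟨j, rfl⟩ := Nat.exists_eq_add_of_lt (Nat.lt_of_not_le hir)
    have hpt : (((Nat.card k : ℚ) ^ m) ^ (r + j + 1)) * ((((Nat.card k : ℚ) ^ m) ^ r)⁻¹) =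
        ((Nat.card k : ℚ) ^ m) ^ (j + 1) := by
      rw [add_assoc, pow_add, mul_right_comm, mul_inv_cancel₀ (pow_ne_zero _ hq), one_mul]
    rw [hpt]
    have hqm : 1 < Nat.card k ^ m := Nat.one_lt_pow hm.ne' Finite.one_lt_card
    -- `Z_m(ℙᵃ) · ∏(1 − (q^m)ʲ'T) = 1` and no factor vanishes at `T = (q^m)^{j+1}` (`(q^m)^{j'+j+1} ≠ 1`)
    refine HasPoleOfOrderAt.of_mul_coe (u := ∏ j' ∈ Finset.range (a + 1),
      (1 - C ((((Nat.card k ^ m : ℕ) : ℚ)) ^ j') * X) ^ 1) ?_ ?_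
    · rw [eval_prod]
      refine Finset.prod_ne_zero_iff.mpr fun j' _ => ?_
      rw [pow_one, eval_sub, eval_one, eval_mul, eval_C, eval_X, Nat.cast_pow, ← pow_add, sub_ne_zero]
      have h1 : (1 : ℚ) < (Nat.card k : ℚ) ^ m := by exact_mod_cast hqm
      exact (one_lt_pow₀ h1 (by omega)).ne
    · rw [zetaSeriesPow_projectiveSpace_mul_coe_prod_pow a hm]
      exact HasPoleOfOrderAt.one _

end EFree

/-! ### §5 In cohomology: `φ_r(Fᵐ) = 1` on `H^{2r}(ℙⁿ)(r)` for every `m` -/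

namespace GaloisWeilCohomology

variable {k : Type u} [Field k] [Finite k] {K : Type v} [Field K] [CharZero K]
  {χ : Field.absoluteGaloisGroup k →* Kˣ} (E : GaloisWeilCohomology k K χ) {n : ℕ}

/-- **`φ_r(Fᵐ) = 1` on `H^{2r}(ℙⁿ)(r)`** (`r ≤ n`, every `m`): every class of `H^{2r}(ℙⁿ)(r)` is fixed by the
Frobenius of every `𝔽_{q^m}` (the tree's `φ_r = 1`, to the `m`-th power). [cite: Tate1994, §1 and §2 Th. 2.9]
[cite: Hartshorne1977, App. C Ex. 5.2] -/
theorem ρTwist_pow_projectiveSpace_two_mul_eq_one (hE : E.HasLefschetzTraceFormula)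
    (hχ : ((χ (arithFrob k) : Kˣ) : K) = Nat.card k)
    (hRH : E.WeilRiemannHypothesisFor (projectiveSpace n k) n) {r : ℕ} (hr : r ≤ n) (m : ℕ) :
    E.ρTwist (projectiveSpace n k) (2 * r) r (geomFrob k ^ m) = 1 := by
  rw [map_pow, E.ρTwist_projectiveSpace_two_mul_eq_one hE hχ hRH hr, one_pow]

/-- **`Ker(φ_r(Fᵐ) − 1) = H^{2r}(ℙⁿ)(r)`** (`r ≤ n`, every `m`). [cite: Tate1994, §1 Conjecture T^r and §2 Th. 2.9] -/
theorem ker_ρTwist_pow_sub_one_projectiveSpace_eq_top (hE : E.HasLefschetzTraceFormula)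
    (hχ : ((χ (arithFrob k) : Kˣ) : K) = Nat.card k)
    (hRH : E.WeilRiemannHypothesisFor (projectiveSpace n k) n) {r : ℕ} (hr : r ≤ n) (m : ℕ) :
    LinearMap.ker (E.ρTwist (projectiveSpace n k) (2 * r) r (geomFrob k ^ m) - 1) = ⊤ := by
  rw [E.ρTwist_pow_projectiveSpace_two_mul_eq_one hE hχ hRH hr m, sub_self, LinearMap.ker_zero]

/-- **`H^{2r}(ℙⁿ)(r) = H^{2r}(ℙⁿ)(r)_{(φ_r(Fᵐ)),1}` for every `r` and `m`** (polynomial point counts, g52-#7).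
[cite: Gottsche1993, §1.2 Remark 1.2.2] [cite: Tate1994, §2 Th. 2.9] -/
theorem maxGenEigenspace_ρTwist_pow_projectiveSpace_eq_top (hE : E.HasLefschetzTraceFormula)
    (hχ : ((χ (arithFrob k) : Kˣ) : K) = Nat.card k)
    (hRH : E.WeilRiemannHypothesisFor (projectiveSpace n k) n) (r m : ℕ) :
    Module.End.maxGenEigenspace (E.ρTwist (projectiveSpace n k) (2 * r) r (geomFrob k ^ m)) 1 = ⊤ :=
  E.maxGenEigenspace_ρTwist_pow_eq_top_of_pointCount_eq_sum hE hχ (isSmoothProjective_projectiveSpace_holds k n)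
    hRH (fun _ hm => pointCount_projectiveSpace_cast hm) r m

/-- **`dim H^{2r}(ℙⁿ)(r)_{(φ_r(Fᵐ)),1} = 1`** (`r ≤ n`, every `m`) — matching the simple pole of
`Z(ℙⁿ ⊗ 𝔽_{q^m}, T)` at `(q^m)^{−r}` (§1). [cite: TateWoodsHole1965, §3] [cite: Kahn2020, §6.14 Conj. 6.52] -/
theorem finrank_maxGenEigenspace_ρTwist_pow_projectiveSpace (hE : E.HasLefschetzTraceFormula)
    (hχ : ((χ (arithFrob k) : Kˣ) : K) = Nat.card k)
    (hRH : E.WeilRiemannHypothesisFor (projectiveSpace n k) n) {r : ℕ} (hr : r ≤ n) (m : ℕ) :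
    Module.finrank K (Module.End.maxGenEigenspace
      (E.ρTwist (projectiveSpace n k) (2 * r) r (geomFrob k ^ m)) 1) = 1 := by
  rw [E.maxGenEigenspace_ρTwist_pow_projectiveSpace_eq_top hE hχ hRH r m, finrank_top,
    E.finrank_projectiveSpace_two_mul hE hχ hRH hr]

end GaloisWeilCohomology

end Literature.AlgebraicGeometry.Motives

end
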